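/-
Copyright: the b2b-balaban T⁴-continuum CRUX team, row NE7b owner lineage `t4-ne7b-p1` (gen 115). Project licence.
-/
import Summits.QuantumFields.BalabanUV.T4Continuum.Spine.NE7b.SupBackgroundLocalisation
import Summits.QuantumFields.BalabanUV.T4Continuum.Spine.NE7b.AugmentedInversePeriodic

/-!
# THE INTERACTING BACKGROUND RESTRICTS TO EVERY TORUS: the small-field background configuration `σ(w)` of the perturbed skeleton
# ((60) `exists_background`), read through its DISPLAYED letters only (the sitewise background equation on the closed ball and the
# uniqueness letter), is `side·s`-PERIODIC whenever the coarse field `w` is `s`-periodic — the fine translate of `σ(w)` solves the same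
# equation with the same block means, so uniqueness identifies it with `σ(w)`; and every `ℓ^∞` solution map of the linearised system
# (the response `Dσ(w)`, the covariance `C̃(w)`) commutes with the torus translations at a periodic background, by (63)'s a-priori
# letter at the zero weight (uniqueness of the linearised system) — the interacting sup road lives on `(ℤ∕side·s ℤ)^d` by restriction
# (row NE7b, node U5c; (60) ∕ (63) ∕ (72) BY NAME, generic in the displayed letters; [folklore])

Cell `pub-balaban`, sub-cell `t4`, spine estimate NE7b (`T4WeightBudget.RelWeightBound`; the cell's OWN estimate — NOT PRINTED in
[Bałaban 1983–89], NOT PROVED).  Crux-route work under `Spine/NE7b/` by the row OWNER (`t4-ne7b-p1` gen 115) under FREEZE (0)'s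
crux-prover clause (FILING-CLAIM C-ne7bp1-g115-12); NOTHING of Bałaban's is named, valued or asserted; no `def`, no notation; zero
`sorry`.  Imports (BY NAME): the owner's (63) `…SupBackgroundLocalisation` (`weighted_apriori`; through it ASE `exists_clm_of_letters`,
`blockAvg_fibreProj`, (58) `abs_apply_le_norm`) and (72) `…AugmentedInversePeriodic` (through it (55) `AX_translate`, `sum_B_translate`,
`blk_translate`, `B5Hk103ScalarZd.tsum_AX_mul`).

WHY (located).  (72) restricted the FREE chart to the periodic subspaces; the interacting objects of (60)–(67) are defined by
equations whose data (block average, site operator, fibre projection, sitewise nonlinearity) are translation covariant, and each comes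
with a uniqueness letter — so they commute with translations, and periodic data give periodic objects.  No torus-side construction.

WHAT IS PROVED ([folklore]; fine translation by `c = side n • t′`, coarse by `t′`; period `c = side n • (s • t)`):
* §1 **`exists_clm_translate`**: the fine translation `(τ_c f)(q) = f(q + c)` as `ℓ^∞ →L ℓ^∞`, `‖τ_c f‖ ≤ ‖f‖`; `translate_norm_le`.
* §2 `sum_AX_translate_apply` (`A(τ_c f)(p) = (Af)(p + c)` for `c = side•t′`), `blockAvg_translate_apply` (`Q′(τ_c f)(y) = (Q′f)(y + t′)`),
  `fibreProj_translate_apply`.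
* §3 **`background_periodic_of_letters`**: for `Q′, A` with the displayed actions and ANY `σ` with (60)'s closed-ball sitewise letter and
  uniqueness letter on radius `r`: `w` in the closed ball and `s`-periodic ⟹ `σ w` is `side·s`-periodic.
* §4 **`linearised_periodic_of_letters`** (`d ≥ 3`, `2λC_Γ(0) < 1`): for `Q′, A, P` displayed, `N′ = g·` with `g` `side·s`-periodic
  (`|g| ≤ λ`), any `ℓ^∞` solution `h` of `Q′h = v`, `P(Ah + N′h) = κ₀` with `v` `s`-periodic and `κ₀` periodic is periodic —
  (63) `weighted_apriori` at `μ = 0` applied to `τ_c h − h`, which solves the system with zero data; covers `Dσ(w)v` and `C̃(w)f` at a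
  periodic background.

HONEST (what this is NOT).  Letters-level statements (a consumer feeds (60)'s ∕ (63)'s objects); no `Fintype` torus carrier; constants
as in (60)∕(63); scalar skeleton; nothing of Bałaban's.  BY-NAME EFFECT ON THE WALL: NONE.  NE7b NOT PRINTED ∕ NOT PROVED; spine
PROVED 0∕9; rung (B)+1 on a FINITE torus — NOT infinite volume, NOT the mass gap, NOT Clay.  HONEST DEPENDENCY: continuum YM on T⁴ ⇐
BetaPertH ∧ nine spine estimates (0∕9 proved); BetaPertH ⇐ (D1) ∧ (D4) ∧ CAP+tail; G-an2-4 gates asym, D1 and NE2∕3∕4.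
-/

set_option autoImplicit false

noncomputable section

namespace Summit.QuantumFields.BalabanUV.T4Continuum.NE7b.SupBackgroundPeriodic

open Set Metric
open scoped ENNReal
open Literature.MathematicalPhysics.QuantumFieldTheory.Balaban1983to89
open B4Sect5Proof (latticeConst latticeConst_nonneg)
open B6QGQLower276 (X blk B mem_B side AX)
open B6QGQDecay237 (deltaU deltaU_pos)
open B5Hk103ScalarZd (nbhd deltaH deltaH_pos tsum_AX_mul)
open Summit.QuantumFields.BalabanUV.Beta.D1BFx.BlockColumnSupNorm (cHs cHs_nonneg)
open Summit.QuantumFields.BalabanUV.Beta.D1BFx.PointColumnSplit (cKL cG0 cSplit)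
open Summit.QuantumFields.BalabanUV.Beta.D1BFx.PointColumnDecay (cFar)
open AugmentedSupEquivalence (exists_clm_of_letters blockAvg_fibreProj)
open LocalNemytskiiSup (abs_apply_le_norm)
open OneShotChartTorusRowsZd (AX_translate sum_B_translate blk_translate)
open SupBackgroundLocalisation (weighted_apriori)

variable {d : ℕ}

/-! ## §1. Fine translations as operators on `ℓ^∞(ℤ^d)` -/

/-- **The fine translation `(τ_c f)(q) = f(q + c)` is an operator on `ℓ^∞` of norm `≤ 1`** (ASE `exists_clm_of_letters`). [folklore] -/
theorem exists_clm_translate (c : X d) :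
    ∃ τ : lp (fun _ : X d => ℝ) ∞ →L[ℝ] lp (fun _ : X d => ℝ) ∞,
      (∀ (f : lp (fun _ : X d => ℝ) ∞) (q : X d), τ f q = f (q + c)) ∧ ‖τ‖ ≤ 1 :=
  exists_clm_of_letters (fun f q => f (q + c)) (fun _ _ _ _ _ _ _ => rfl) (fun _ _ _ _ _ => rfl) zero_le_one
    fun f R hf q => by rw [one_mul]; exact hf (q + c)

/-- `‖τ_c f‖ ≤ ‖f‖` for any operator with the displayed action. [folklore] -/
theorem translate_norm_le (c : X d) (τ : lp (fun _ : X d => ℝ) ∞ →L[ℝ] lp (fun _ : X d => ℝ) ∞)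
    (hτ : ∀ (f : lp (fun _ : X d => ℝ) ∞) (q : X d), τ f q = f (q + c)) (f : lp (fun _ : X d => ℝ) ∞) : ‖τ f‖ ≤ ‖f‖ :=
  lp.norm_le_of_forall_le (norm_nonneg f) fun q => by rw [Real.norm_eq_abs, hτ]; exact abs_apply_le_norm f (q + c)

/-! ## §2. The displayed actions commute with block translations -/

/-- `A(τ_c f)(p) = (Af)(p + c)` for a block translation `c = side•t′` ((55) `AX_translate`, reindexing). [folklore] -/
theorem sum_AX_translate_apply (n : ℕ) (a : ℝ) (t' : X d) {f g : X d → ℝ} (hg : ∀ q, g q = f (q + side n • t')) (p : X d) :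
    ∑ r ∈ nbhd n p, AX n a p r * g r = ∑ r ∈ nbhd n (p + side n • t'), AX n a (p + side n • t') r * f r := by
  rw [← tsum_AX_mul, ← tsum_AX_mul, ← (Equiv.addRight (side n • t')).tsum_eq (fun r => AX n a (p + side n • t') r * f r)]
  exact tsum_congr fun r => by rw [Equiv.coe_addRight, AX_translate, hg]

/-- `Q′(τ_c f)(y) = (Q′f)(y + t′)` for `c = side•t′` ((55) `sum_B_translate`). [folklore] -/
theorem blockAvg_translate_apply (n : ℕ) (t' : X d) {f g : X d → ℝ} (hg : ∀ q, g q = f (q + side n • t')) (y : X d) :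
    (((n : ℝ) + 1) ^ d)⁻¹ * ∑ q ∈ B n y, g q = (((n : ℝ) + 1) ^ d)⁻¹ * ∑ q ∈ B n (y + t'), f q := by
  rw [sum_B_translate]; exact congrArg _ (Finset.sum_congr rfl fun q _ => hg q)

/-- `P(τ_c f)(p) = (Pf)(p + c)` for `c = side•t′` ((55) `blk_translate`). [folklore] -/
theorem fibreProj_translate_apply (n : ℕ) (t' : X d) {f g : X d → ℝ} (hg : ∀ q, g q = f (q + side n • t')) (p : X d) :
    g p - (((n : ℝ) + 1) ^ d)⁻¹ * ∑ q ∈ B n (blk n p), g q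
      = f (p + side n • t') - (((n : ℝ) + 1) ^ d)⁻¹ * ∑ q ∈ B n (blk n (p + side n • t')), f q := by
  rw [hg, blockAvg_translate_apply n t' hg, blk_translate]

/-! ## §3. The background configuration of a periodic coarse field is periodic -/

/-- **THE BACKGROUND OF AN `s`-PERIODIC COARSE FIELD IS `side·s`-PERIODIC**, for `Q′, A` with the displayed actions and ANY `σ` with
(60)'s two letters on radius `r` over a set `S` of coarse fields: the closed-ball sitewise background equation (`‖σ w‖ ≤ r`, `Q′(σ w) = w`,
`A(σw)(p) + u(σw(p)) =` its block mean) and the uniqueness letter (`‖φ‖ ≤ r` and the sitewise equation ⟹ `σ(Q′φ) = φ`): the fine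
translate of `σ w` is a competitor with the same block means. [folklore] -/
theorem background_periodic_of_letters (n : ℕ) {a : ℝ} (Dop Aop : lp (fun _ : X d => ℝ) ∞ →L[ℝ] lp (fun _ : X d => ℝ) ∞)
    (hD : ∀ (f : lp (fun _ : X d => ℝ) ∞) (y : X d), Dop f y = (((n : ℝ) + 1) ^ d)⁻¹ * ∑ p ∈ B n y, f p)
    (hA : ∀ (f : lp (fun _ : X d => ℝ) ∞) (p : X d), Aop f p = ∑ r ∈ nbhd n p, AX n a p r * f r)
    {u : ℝ → ℝ} {r : ℝ} {σ : lp (fun _ : X d => ℝ) ∞ → lp (fun _ : X d => ℝ) ∞} {S : Set (lp (fun _ : X d => ℝ) ∞)}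
    (hσ : ∀ w ∈ S, σ w ∈ closedBall 0 r ∧ Dop (σ w) = w ∧
      ∀ p : X d, Aop (σ w) p + u (σ w p) = (((n : ℝ) + 1) ^ d)⁻¹ * ∑ p' ∈ B n (blk n p), (Aop (σ w) p' + u (σ w p')))
    (huniq : ∀ φ ∈ closedBall (0 : lp (fun _ : X d => ℝ) ∞) r,
      (∀ p : X d, Aop φ p + u (φ p) = (((n : ℝ) + 1) ^ d)⁻¹ * ∑ p' ∈ B n (blk n p), (Aop φ p' + u (φ p'))) → σ (Dop φ) = φ)
    (s : ℕ) {w : lp (fun _ : X d => ℝ) ∞} (hw : w ∈ S) (hper : ∀ y t : X d, w (y + (s : ℤ) • t) = w y) (q t : X d) :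
    σ w (q + side n • ((s : ℤ) • t)) = σ w q := by
  obtain ⟨hball, hDw, heq⟩ := hσ w hw
  obtain ⟨τ, hτ, -⟩ := exists_clm_translate (side n • ((s : ℤ) • t))
  -- the translate is a competitor: same radius, same block means, same sitewise equation
  have hφball : τ (σ w) ∈ closedBall (0 : lp (fun _ : X d => ℝ) ∞) r := by
    rw [mem_closedBall, dist_zero_right] at hball ⊢
    exact (translate_norm_le _ τ hτ (σ w)).trans hball
  have hAτ : ∀ p : X d, Aop (τ (σ w)) p = Aop (σ w) (p + side n • ((s : ℤ) • t)) := fun p => by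
    rw [hA, hA]; exact sum_AX_translate_apply n a ((s : ℤ) • t) (fun q' => hτ (σ w) q') p
  have hφeq : ∀ p : X d, Aop (τ (σ w)) p + u (τ (σ w) p)
      = (((n : ℝ) + 1) ^ d)⁻¹ * ∑ p' ∈ B n (blk n p), (Aop (τ (σ w)) p' + u (τ (σ w) p')) := by
    intro p
    rw [hAτ, hτ, heq (p + side n • ((s : ℤ) • t)), blk_translate, sum_B_translate]
    exact congrArg _ (Finset.sum_congr rfl fun p' _ => by rw [hAτ, hτ])
  have hDφ : Dop (τ (σ w)) = w := by
    refine lp.ext (funext fun y => ?_)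
    rw [hD, blockAvg_translate_apply n ((s : ℤ) • t) (fun q' => hτ (σ w) q') y, ← hD, hDw, hper]
  have h := huniq _ hφball hφeq
  rw [hDφ] at h
  have h' := congrArg (fun f : lp (fun _ : X d => ℝ) ∞ => f q) h
  simp only [hτ] at h'
  exact h'.symm

/-! ## §4. Solutions of the linearised system at a periodic background are periodic -/

/-- **ℓ^∞ SOLUTIONS OF THE LINEARISED SYSTEM WITH PERIODIC DATA ARE PERIODIC** (`d ≥ 3`, `2λC_Γ(0) < 1`): for `Q′, A, P` with the
displayed actions, a diagonal `N′ = g·` with `g` `side·s`-periodic and `|g| ≤ λ`, and `h, v, κ₀ ∈ ℓ^∞` with `Q′h = v`,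
`P(Ah + N′h) = κ₀`, `v` `s`-periodic, `κ₀` periodic: `h` is periodic — `τ_c h − h` solves the system with zero data, and (63)
`weighted_apriori` at the zero weight bounds it by `0`.  (Covers `Dσ(w)v` and `C̃(w)f` of (60) ∕ (63) at a periodic background `σ w`,
with `g = u′∘σ w`.) [folklore] -/
theorem linearised_periodic_of_letters (hd : 3 ≤ d) (n : ℕ) {a : ℝ} (ha : 0 < a)
    (Dop Aop Pop Nop : lp (fun _ : X d => ℝ) ∞ →L[ℝ] lp (fun _ : X d => ℝ) ∞)
    (hD : ∀ (f : lp (fun _ : X d => ℝ) ∞) (y : X d), Dop f y = (((n : ℝ) + 1) ^ d)⁻¹ * ∑ p ∈ B n y, f p)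
    (hA : ∀ (f : lp (fun _ : X d => ℝ) ∞) (p : X d), Aop f p = ∑ r ∈ nbhd n p, AX n a p r * f r)
    (hP : ∀ (f : lp (fun _ : X d => ℝ) ∞) (p : X d), Pop f p = f p - (((n : ℝ) + 1) ^ d)⁻¹ * ∑ p' ∈ B n (blk n p), f p')
    {g : X d → ℝ} {lam : ℝ} (hN : ∀ (f : lp (fun _ : X d => ℝ) ∞) (p : X d), Nop f p = g p * f p) (hg : ∀ p, |g p| ≤ lam)
    (hsmall : 2 * lam * (((cG0 d * cKL d (d - 2) + cSplit d a) * Real.exp (2 * deltaU d a)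
        + cFar d a * Real.exp (4 * deltaU d a) / deltaU d a ^ 2) * latticeConst d (deltaU d a / 4)
          * (1 + cHs d a * latticeConst d (deltaH d a))) < 1)
    (s : ℕ) (hgper : ∀ q t : X d, g (q + side n • ((s : ℤ) • t)) = g q)
    (h v κ₀ : lp (fun _ : X d => ℝ) ∞) (h1 : Dop h = v) (h2 : Pop (Aop h + Nop h) = κ₀)
    (hv : ∀ y t : X d, v (y + (s : ℤ) • t) = v y) (hκ : ∀ q t : X d, κ₀ (q + side n • ((s : ℤ) • t)) = κ₀ q) (q t : X d) :
    h (q + side n • ((s : ℤ) • t)) = h q := by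
  obtain ⟨τ, hτ, -⟩ := exists_clm_translate (side n • ((s : ℤ) • t))
  -- the difference `k := τ h − h` solves the system with zero data
  have hAτ : ∀ (f : lp (fun _ : X d => ℝ) ∞) (p : X d), Aop (τ f) p = Aop f (p + side n • ((s : ℤ) • t)) := fun f p => by
    rw [hA, hA]; exact sum_AX_translate_apply n a ((s : ℤ) • t) (fun q' => hτ f q') p
  have hDτ : ∀ (f : lp (fun _ : X d => ℝ) ∞) (y : X d), Dop (τ f) y = Dop f (y + (s : ℤ) • t) := fun f y => by
    rw [hD, hD]; exact blockAvg_translate_apply n ((s : ℤ) • t) (fun q' => hτ f q') y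
  have hPτ : ∀ (f : lp (fun _ : X d => ℝ) ∞) (p : X d), Pop (τ f) p = Pop f (p + side n • ((s : ℤ) • t)) := fun f p => by
    rw [hP, hP]; exact fibreProj_translate_apply n ((s : ℤ) • t) (fun q' => hτ f q') p
  have hk1 : Dop (τ h - h) = 0 := by
    refine lp.ext (funext fun y => ?_)
    rw [map_sub, lp.coeFn_sub, Pi.sub_apply, hDτ, h1, hv, sub_self, lp.coeFn_zero, Pi.zero_apply]
  have hk2 : Pop (Aop (τ h - h) + Nop (τ h - h)) = 0 := by
    have e : Aop (τ h - h) + Nop (τ h - h) = (Aop (τ h) + Nop (τ h)) - (Aop h + Nop h) := by rw [map_sub, map_sub]; abel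
    have e2 : Aop (τ h) + Nop (τ h) = τ (Aop h + Nop h) := by
      refine lp.ext (funext fun p => ?_)
      rw [lp.coeFn_add, Pi.add_apply, hAτ, hN, hτ, hτ, lp.coeFn_add, Pi.add_apply, hN, hgper]
    rw [e, map_sub, e2, h2]
    refine lp.ext (funext fun p => ?_)
    rw [lp.coeFn_sub, Pi.sub_apply, hPτ, h2, hκ, lp.coeFn_zero, Pi.zero_apply, sub_self]
  -- (63)'s a-priori letter at the zero weight with zero data
  have hz : ∀ y : X d, Real.exp (0 * (0 : ℝ)) * |(0 : lp (fun _ : X d => ℝ) ∞) y| ≤ 0 := fun y => by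
    rw [lp.coeFn_zero, Pi.zero_apply, abs_zero, mul_zero]
  have hsmall' : 2 * lam * (((cG0 d * cKL d (d - 2) + cSplit d a) * Real.exp (2 * deltaU d a)
      + cFar d a * Real.exp (4 * deltaU d a) / deltaU d a ^ 2) * latticeConst d (deltaU d a / 4 - 0)
        * (1 + cHs d a * latticeConst d (deltaH d a - 0))) < 1 := by rwa [sub_zero, sub_zero]
  have hb := weighted_apriori hd n ha Dop Aop Pop Nop hD hA hP hN hg (μ := 0) le_rfl (deltaH_pos d ha)
    (by have := deltaU_pos d ha; positivity) hsmall' (ρ := fun _ => (0 : ℝ)) (fun _ _ => by rw [sub_self]; exact dist_nonneg)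
    (Mρ := 0) (fun _ => by rw [abs_zero]) (τ h - h) 0 0 (map_zero Dop) hk1 hk2 hz hz q
  have hb' : |(τ h - h) q| ≤ 0 := by
    simpa only [mul_zero, zero_mul, add_zero, zero_add, Real.exp_zero, one_mul] using hb
  have e3 := abs_nonpos_iff.1 hb'
  rw [lp.coeFn_sub, Pi.sub_apply, sub_eq_zero, hτ] at e3
  exact e3

end Summit.QuantumFields.BalabanUV.T4Continuum.NE7b.SupBackgroundPeriodic

end
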